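import Literature.MathematicalPhysics.QuantumFieldTheory.Balaban1983to89.B16NodeKnitRecord13CoPH
import Literature.MathematicalPhysics.QuantumFieldTheory.Balaban1983to89.B15Claim189N0OfRecord
import Literature.MathematicalPhysics.QuantumFieldTheory.Balaban1983to89.B10Eq41TorusHistories
import Literature.MathematicalPhysics.QuantumFieldTheory.Balaban1983to89.Node00.Record13NumericsOfThm1CCMW

/-!
# BalabanUVNodes ∕ N13 — THE LEVEL-`0` CONJUNCT OF N13's (UV₁₃) ROW `hUV` AT NODE 00's STAGE-13 RECORD: [Balaban1989LargeFieldII] (0.1) ∕ [Balaban1988Convergent] Cor. 3 (2.50)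
# AT `k = 0`, PROVED FROM THE RECORD's OWN OBJECTS (`ρ₀ = e^{−E}·exp(−g₀⁻²A)` is explicit), with the normalisation `E = EOfRecord₁₃ θ P` ([III] (1.15) p. 249, Thm 1 p. 262)
# bounded two-sidedly by `|T₁^{(0)}|` at every parameter whose fluctuation-counterterm slots read `Efl = logz = 0` (every K0-class witness of the tree, by `rfl`)

Cell `pub-ymgap` (HUMAN RULING D-0062 Track A; D-0149 width seat `pub-ymgap-dag-n13-w1`, g0, INTENT-2), key K1⁷ `StabilityBAtRecordR13SepCoPH` = stmt-QuantumFields-20542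
(`--kind proof --supports … --as helper`).  [III] = [Balaban1988Convergent], [I] = [Balaban1987RG1], [B16] = [Balaban1989LargeFieldII].

WHY.  In K1⁷'s kernel form (dag-n12-d `…N12AtRecord13SepCoPHSockets.nodes₁₃CoPH_upS_fourPinW₀_pointed`, dag-n24-c's thin layer `Node00/N24ItemsStage13SepCoPH`) node N13 enters through
two rows: (R₁₃) `hR` (law transport by 𝐑 — a theorem on every law-abiding selector, `Lit/…/B16RLeafRecord13SepCoPHSelLaws`) and (UV₁₃) `hUV`: for every run `P` in the window and every
§2-format level `k ≤ P.K`, `χβ_k·exp(−g_k⁻²·A^η_k − em(g_k)·|T₁^{(k)}|) ≤ densOfRecord₁₃ θ P k ≤ exp(ep(g_k)·|T₁^{(k)}|)` POINTWISE.  Levels `k ≥ 1` are [B16] Theorem 1 + Cor. 3 proper (the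
junction `B16NodeKnitRecord13CoPH.uvIneq_at_record₁₃CoPH_of_gas`, whose (1.72)-representation binder `hH` has no supplier).  THE LEVEL `k = 0` IS ELEMENTARY AND HAD NO SUPPLIER: this file.

WHAT THIS FILE PROVES (theorems only, 0 `def`).
§1 E-KEYED, every `θ : Stage13Params`: `densOfRecord₁₃_zero_apply` (`ρ₀(U) = e^{−E}·exp(−g₀⁻²·A(U))`), `wilsonAction4_le_two_mul_card_plaq` (`A ≤ 2·#Plaq`, `|Re tr| ≤ 1`),
   `card_plaq_P` (`#Plaq(T^{(j)}) = 6·|T^{(j)}|` at `d = 4`), ★ `uv_upper_zero_of_negE_le` (`−E ≤ e₊·|T^{(0)}| ⇒ ρ₀ ≤ exp(e₊·|T^{(0)}|)`), ★ `uv_lower_zero_of_E_le`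
   (`E ≤ e₋·|T^{(0)}| ⇒ χβ₀·exp(−g₀⁻²·A^η₀ − (e₋ + 12·g₀⁻²)·|T^{(0)}|) ≤ ρ₀`; `A^η₀ ≥ 0`, `χβ₀ ∈ [0,1]`, `A ≤ 12·|T^{(0)}|`).
§2 THE E-BOUNDS at `θ.Efl = 0 ∧ θ.logz = 0` (`stage8OfNumericsD`: all K0a ∕ K0 witnesses): `eStepOfRecord_of_Efl_logz` (`e_j = (d(𝔤)·log g_j + log σ₀)·T*_j`), `tstarCount_P_nonneg`,
   `sum_tstarCount_P_range` (`Σ_{j<K} T*_j = 4(|T^{(0)}| − |T^{(K)}|)`), ★ `EOfRecord₁₃_le_of_inInterval` (`0 < g_j ≤ γ ≤ 1` ⇒ `E ≤ 4·max(log σ₀,0)·|T^{(0)}|`), ★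
   `neg_EOfRecord₁₃_le_of_inInterval_of_betaLowerH` (+ `0 ≤ β` on the γ-box ⇒ `g₀ ≤ g_j` by `B15Claim189N0OfRecord.genSeq_mono_of_beta_nonneg` ⇒ `−E ≤ 4·(d(𝔤)·log g₀⁻¹ + max(−log σ₀,0))·|T^{(0)}|`).
§3 ★★ `uv_zero_densOfRecord₁₃_of_Efl_logz_of_inInterval_of_betaLowerH`: BOTH SIDES OF (UV₁₃) AT `k = 0` in the engines' exact currency with the EXPLICIT dependence functions
   `em₀(g₀) := 4·max(log σ₀,0) + 12·g₀⁻²`, `ep₀(g₀) := 4·(d(𝔤)·log g₀⁻¹ + max(−log σ₀,0))` of `g₀ = g_k|_{k=0}` ALONE ([III] Cor. 3 «depending on g_k»; the pv24 necessity `E₊ ≥ c·log g₀⁻¹ − C₀`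
   of `B16B10Shape.ep_lower_of_uvIneq_zero` is met with the same shape); the datum form `uvIneq_zero_datumOfRecord₁₃CoPH_…` (`B16.UVIneq ((datumOfRecord₁₃CoPH θ h).C P) 0 V em₀ ep₀`).
§4 the instance at the K0⁷ witness family `theta13OfThm1CCMW F N j γ ε₀ ε₂₉ B₃ B₃' a₀ a₁` (`Efl = logz = 0`, `log σ₀`, `d(𝔤)` by `rfl`).

HONEST FRAMING.  LEVEL `k = 0` ONLY: `ρ₀` is the explicit Wilson weight, so NO estimate of Bałaban's is used or asserted; the hypotheses (window `InInterval γ P.K` with `γ ≤ 1`, the SIGN floor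
`BetaLowerH 0 γ (betaOfRecord₁₃ θ)` = n24-w1's located letter of the END road, `Efl = logz = 0`) are DISPLAYED; levels `k ≥ 1` of (UV₁₃) — the content of [B16] — are untouched; N13 is NOT
discharged; count-neutral helper; one finite `𝕋⁴_{L^K}` programme at fixed `ε = L^{−K}` — NOT a continuum ∕ ℝ⁴ ∕ OS ∕ mass-gap ∕ Clay statement.  No `def`, no `sorry`, no `instance`.
-/

noncomputable section

open MeasureTheory
open scoped BigOperators

namespace Summit.QuantumFields.YangMills.BalabanUVNodes.N13UV01LevelZeroAtRecord13

open Literature.MathematicalPhysics.QuantumFieldTheory.Balaban1983to89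
open Literature.MathematicalPhysics.QuantumFieldTheory.Balaban1983to89.T4Continuum
open Literature.MathematicalPhysics.QuantumFieldTheory.Balaban1983to89.Node00
open Literature.MathematicalPhysics.QuantumFieldTheory.Balaban1983to89.FlowStepRuns (genFlow genSeq genSeq_zero)
open Literature.MathematicalPhysics.QuantumFieldTheory.Balaban1983to89.FlowStep (HBeta prefixOf BetaLowerH)
open Literature.MathematicalPhysics.QuantumFieldTheory.Balaban1983to89.B15Claim189N0OfRecord (genSeq_mono_of_beta_nonneg betaAlongHistory_nonneg_of_betaLowerH)
open Literature.MathematicalPhysics.QuantumFieldTheory.Balaban1983to89.B10Eq41TorusHistories (card_plaq)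

variable {F : T4Family} {N : ℕ} [NeZero N]

/-! ## §1 E-keyed level-`0` bounds for every `θ : Stage13Params F N` -/

section EKeyed

variable (θ : Stage13Params F N) (P : B12.RunParams)

/-- **`ρ₀(U) = e^{−E(P)}·exp(−g₀⁻²·A(U))`** — def-T's `densOfRecord₁₃_zero` with `rhoZeroOfRecord` ∕ `Missing.boltzmann` unfolded. [III] Thm 1 p.262: «ρ₀ = exp[−(1∕g₀²)A − E]». -/
theorem densOfRecord₁₃_zero_apply (U : GaugeField (F.P P.K) 0 (SU N)) :
    densOfRecord₁₃ F N θ P 0 U = Real.exp (-(EOfRecord₁₃ F N θ P)) * Real.exp (-(P.g0⁻¹ ^ 2) * wilsonAction4 U) := by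
  rw [densOfRecord₁₃_zero]
  rfl

/-- **`A(U) ≤ 2·#Plaq(T^{(j)})`** (each Wilson term `1 − Re tr U(∂p) ∈ [0, 2]`, `|Re tr| ≤ 1` on `SU(N)`). [I] (0.2) p.252. -/
theorem wilsonAction4_le_two_mul_card_plaq {P' : Params} {j : ℕ} (U : GaugeField P' j (SU N)) :
    wilsonAction4 U ≤ 2 * (Fintype.card (Plaq P' j) : ℝ) := by
  unfold wilsonAction4 wilsonAction
  calc ∑ p : Plaq P' j, (1 : ℝ) * (1 - reTr (GaugeField.plaqHol U p))
      ≤ ∑ _p : Plaq P' j, (2 : ℝ) := Finset.sum_le_sum fun p _ => by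
        rw [one_mul]; exact (RegularGaugeGroup.one_sub_reTr_mem_Icc (GaugeField.plaqHol U p)).2
    _ = 2 * (Fintype.card (Plaq P' j) : ℝ) := by
        rw [Finset.sum_const, Finset.card_univ, nsmul_eq_mul, mul_comm]

/-- **`#Plaq(T^{(j)}) = 6·|T^{(j)}|` on Bałaban's four-dimensional tori** (`d = 4`: six plane orientations per site). [I] (0.1)–(0.2) pp.251–252. -/
theorem card_plaq_P (K j : ℕ) : Fintype.card (Plaq (F.P K) j) = 6 * Fintype.card (Site (F.P K) j) := by
  rw [card_plaq, mul_comm]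
  congr 1

/-- `A(U) ≤ 12·|T^{(j)}|` on the four-dimensional tori. [I] (0.2) p.252. -/
theorem wilsonAction4_le_twelve_mul_card_site {K j : ℕ} (U : GaugeField (F.P K) j (SU N)) :
    wilsonAction4 U ≤ 12 * (Fintype.card (Site (F.P K) j) : ℝ) := by
  have h := wilsonAction4_le_two_mul_card_plaq (N := N) U
  rw [card_plaq_P, Nat.cast_mul] at h
  push_cast at h
  linarith

/-- **★ THE UPPER HALF OF (UV₁₃) AT `k = 0`, E-KEYED**: `−E(P) ≤ e₊·|T^{(0)}| ⇒ ρ₀(U) ≤ exp(e₊·|T^{(0)}|)` (`ρ₀ ≤ e^{−E}`, def-K0b's `rhoZeroOfRecord_le`). [B16] (0.1) p.356; [III] (2.50) p.264. -/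
theorem uv_upper_zero_of_negE_le {ep : ℝ} (hE : -(EOfRecord₁₃ F N θ P) ≤ ep * (Fintype.card (Site (F.P P.K) 0) : ℝ)) (U : GaugeField (F.P P.K) 0 (SU N)) :
    densOfRecord₁₃ F N θ P 0 U ≤ Real.exp (ep * (Fintype.card (Site (F.P P.K) 0) : ℝ)) := by
  rw [densOfRecord₁₃_zero]
  exact (rhoZeroOfRecord_le F N P.K P.g0 _ U).trans (Real.exp_le_exp.mpr hE)

/-- **★ THE LOWER HALF OF (UV₁₃) AT `k = 0`, E-KEYED**: `E(P) ≤ e₋·|T^{(0)}| ⇒ χβ₀(U)·exp(−g₀⁻²·A^η₀(U) − (e₋ + 12·g₀⁻²)·|T^{(0)}|) ≤ ρ₀(U)` — `χβ₀ ∈ [0,1]` (K0e), `A^η₀ ≥ 0`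
(`wilsonBGOfRecord_nonneg`), `A(U) ≤ 12·|T^{(0)}|`; in the engines' currency (`g₀ = gOfRecord₁₃ θ P 0`). [B16] (0.1) p.356; [III] (2.50) p.264. -/
theorem uv_lower_zero_of_E_le {em : ℝ} (hE : EOfRecord₁₃ F N θ P ≤ em * (Fintype.card (Site (F.P P.K) 0) : ℝ)) (U : GaugeField (F.P P.K) 0 (SU N)) :
    chiβOfRecord₁₃ F N θ P.K (gOfRecord₁₃ F N θ P) 0 U *
        Real.exp (-(1 / (gOfRecord₁₃ F N θ P 0)) ^ 2 * wilsonBGOfRecord F N θ.εbg P 0 U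
          - (em + 12 * (1 / P.g0) ^ 2) * (Fintype.card (Site (F.P P.K) 0) : ℝ)) ≤
      densOfRecord₁₃ F N θ P 0 U := by
  have hχ := chiFix29OfRecord_mem_Icc (F := F) (N := N) θ.ν θ.ε₂₉ P.K 0 U
  have hχ0 : 0 ≤ chiβOfRecord₁₃ F N θ P.K (gOfRecord₁₃ F N θ P) 0 U := hχ.1
  have hχ1 : chiβOfRecord₁₃ F N θ P.K (gOfRecord₁₃ F N θ P) 0 U ≤ 1 := hχ.2
  have hA : 0 ≤ wilsonBGOfRecord F N θ.εbg P 0 U := wilsonBGOfRecord_nonneg F N θ.εbg P 0 U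
  have hA' : wilsonAction4 U ≤ 12 * (Fintype.card (Site (F.P P.K) 0) : ℝ) := wilsonAction4_le_twelve_mul_card_site U
  have hg0 : gOfRecord₁₃ F N θ P 0 = P.g0 := genSeq_zero _ _
  rw [hg0, densOfRecord₁₃_zero_apply, ← Real.exp_add]
  have hsq : 0 ≤ (1 / P.g0) ^ 2 := sq_nonneg _
  have hcard : 0 ≤ (Fintype.card (Site (F.P P.K) 0) : ℝ) := Nat.cast_nonneg _
  calc chiβOfRecord₁₃ F N θ P.K (gOfRecord₁₃ F N θ P) 0 U *
          Real.exp (-(1 / P.g0) ^ 2 * wilsonBGOfRecord F N θ.εbg P 0 U - (em + 12 * (1 / P.g0) ^ 2) * (Fintype.card (Site (F.P P.K) 0) : ℝ))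
      ≤ 1 * Real.exp (-(1 / P.g0) ^ 2 * wilsonBGOfRecord F N θ.εbg P 0 U - (em + 12 * (1 / P.g0) ^ 2) * (Fintype.card (Site (F.P P.K) 0) : ℝ)) :=
        mul_le_mul_of_nonneg_right hχ1 (Real.exp_pos _).le
    _ ≤ Real.exp (-(EOfRecord₁₃ F N θ P) + -(P.g0⁻¹ ^ 2) * wilsonAction4 U) := by
        rw [one_mul]
        apply Real.exp_le_exp.mpr
        have h1 : -(1 / P.g0) ^ 2 * wilsonBGOfRecord F N θ.εbg P 0 U ≤ 0 := by
          have := mul_nonneg hsq hA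
          linarith
        have h2 : P.g0⁻¹ ^ 2 * wilsonAction4 U ≤ (1 / P.g0) ^ 2 * (12 * (Fintype.card (Site (F.P P.K) 0) : ℝ)) := by
          rw [one_div]
          exact mul_le_mul_of_nonneg_left hA' (by rw [← one_div]; exact hsq)
        nlinarith [h1, h2, hE, mul_nonneg hsq hcard]

end EKeyed

/-! ## §2 The normalisation `E` at `Efl = logz = 0`: two-sided bounds by `|T₁^{(0)}|` along windowed runs -/

section EBounds

variable (θ : Stage13Params F N) (P : B12.RunParams)

/-- **The one-step vacuum-energy expression at `Efl = logz = 0`**: `e_j = (d(𝔤)·log g_j + log σ₀)·|T^{(j)*}|`. [III] (1.15) p.249; p.254. -/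
theorem eStepOfRecord_of_Efl_logz (hEfl : ∀ j, θ.Efl P j = 0) (hlogz : ∀ j, θ.logz P j = 0) (g : ℕ → ℝ) (j : ℕ) :
    eStepOfRecord N θ.ν (θ.Efl P) (θ.logz P) g (F.P P.K) j
      = (Real.log (g j) * (dimSU N : ℕ) + θ.ν.logσ₀) * tstarCount (F.P P.K) j := by
  unfold eStepOfRecord
  rw [hEfl, hlogz]
  ring

/-- **`E(P) = Σ_{j<K} (d(𝔤)·log g_j + log σ₀)·|T^{(j)*}|` at `Efl = logz = 0`** along the generated history `g_j = gOfRecord₁₃ θ P j`. [III] Thm 1 p.262; (1.15) p.249. -/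
theorem EOfRecord₁₃_eq_sum_of_Efl_logz (hEfl : ∀ j, θ.Efl P j = 0) (hlogz : ∀ j, θ.logz P j = 0) :
    EOfRecord₁₃ F N θ P = ∑ j ∈ Finset.range P.K, (Real.log (gOfRecord₁₃ F N θ P j) * (dimSU N : ℕ) + θ.ν.logσ₀) * tstarCount (F.P P.K) j := by
  show ∑ j ∈ Finset.range P.K, eStepOfRecord N θ.ν (θ.Efl P) (θ.logz P) (gOfRecord₁₃ F N θ P) (F.P P.K) j = _
  exact Finset.sum_congr rfl fun j _ => eStepOfRecord_of_Efl_logz θ P hEfl hlogz _ j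

/-- **`|T^{(j)*}| = 4(|T^{(j)}| − |T^{(j+1)}|) ≥ 0` in the standing range** (`|T^{(j)}| = L⁴·|T^{(j+1)}|`, `Site.card_site_eq_mul_succ`). [III] (1.15) p.249 (bookkeeping). -/
theorem tstarCount_P_nonneg {K j : ℕ} (hj : j + 1 ≤ F.m + K) : 0 ≤ tstarCount (F.P K) j := by
  unfold tstarCount sitesCard
  have h := Site.card_site_eq_mul_succ (P := F.P K) (j := j) (by simpa using hj)
  have hL : 1 ≤ (F.P K).L ^ (F.P K).d := Nat.one_le_pow _ _ (by have := F.hL.2; simp; omega)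
  have hle : Fintype.card (Site (F.P K) (j + 1)) ≤ Fintype.card (Site (F.P K) j) := by
    rw [h]; exact Nat.le_mul_of_pos_left _ hL
  have : (Fintype.card (Site (F.P K) (j + 1)) : ℝ) ≤ Fintype.card (Site (F.P K) j) := by exact_mod_cast hle
  linarith

/-- **TELESCOPING: `Σ_{j<K} |T^{(j)*}| = 4(|T^{(0)}| − |T^{(K)}|)`.** [III] (1.15) p.249; p.262 «a sum of all such expressions … for all the lattices T^{(k)}» (bookkeeping). -/
theorem sum_tstarCount_P_range (K' K : ℕ) :
    ∑ j ∈ Finset.range K, tstarCount (F.P K') j = 4 * sitesCard (F.P K') 0 - 4 * sitesCard (F.P K') K := by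
  unfold tstarCount
  rw [Finset.sum_range_sub' (fun j => 4 * sitesCard (F.P K') j) K]

/-- `Σ_{j<K} |T^{(j)*}| ≤ 4·|T^{(0)}|`. [III] (1.15) p.249 (bookkeeping). -/
theorem sum_tstarCount_P_range_le (K' K : ℕ) :
    ∑ j ∈ Finset.range K, tstarCount (F.P K') j ≤ 4 * (Fintype.card (Site (F.P K') 0) : ℝ) := by
  rw [sum_tstarCount_P_range]
  unfold sitesCard
  have : 0 ≤ (Fintype.card (Site (F.P K') K) : ℝ) := Nat.cast_nonneg _
  linarith

/-- **★ `E(P) ≤ 4·max(log σ₀, 0)·|T^{(0)}|` ALONG A WINDOWED RUN** (`0 < g_j ≤ γ ≤ 1` for `j ≤ K`, so `log g_j ≤ 0`), at `Efl = logz = 0`. [III] Thm 1 p.262; (1.15) p.249; [B16] Thm 1 p.355 (the window). -/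
theorem EOfRecord₁₃_le_of_inInterval (hEfl : ∀ j, θ.Efl P j = 0) (hlogz : ∀ j, θ.logz P j = 0) {γ : ℝ} (hγ : γ ≤ 1)
    (hI : (genFlow (betaOfRecord₁₃ F N θ) P.g0).InInterval γ P.K) :
    EOfRecord₁₃ F N θ P ≤ 4 * max θ.ν.logσ₀ 0 * (Fintype.card (Site (F.P P.K) 0) : ℝ) := by
  rw [EOfRecord₁₃_eq_sum_of_Efl_logz θ P hEfl hlogz]
  have hstep : ∀ j ∈ Finset.range P.K,
      (Real.log (gOfRecord₁₃ F N θ P j) * (dimSU N : ℕ) + θ.ν.logσ₀) * tstarCount (F.P P.K) j ≤ max θ.ν.logσ₀ 0 * tstarCount (F.P P.K) j := by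
    intro j hj
    have hjK : j < P.K := Finset.mem_range.mp hj
    have hg := hI j hjK.le
    have hlog : Real.log (gOfRecord₁₃ F N θ P j) ≤ 0 := Real.log_nonpos hg.1.le (hg.2.trans hγ)
    have hd : (0 : ℝ) ≤ (dimSU N : ℕ) := Nat.cast_nonneg _
    have hT : 0 ≤ tstarCount (F.P P.K) j := tstarCount_P_nonneg (by simp; omega)
    have h1 : Real.log (gOfRecord₁₃ F N θ P j) * (dimSU N : ℕ) + θ.ν.logσ₀ ≤ max θ.ν.logσ₀ 0 := by
      have := mul_nonpos_of_nonpos_of_nonneg hlog hd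
      linarith [le_max_left θ.ν.logσ₀ 0]
    exact mul_le_mul_of_nonneg_right h1 hT
  refine (Finset.sum_le_sum hstep).trans ?_
  rw [← Finset.mul_sum]
  have hm : 0 ≤ max θ.ν.logσ₀ 0 := le_max_right _ _
  calc max θ.ν.logσ₀ 0 * ∑ j ∈ Finset.range P.K, tstarCount (F.P P.K) j
      ≤ max θ.ν.logσ₀ 0 * (4 * (Fintype.card (Site (F.P P.K) 0) : ℝ)) := mul_le_mul_of_nonneg_left (sum_tstarCount_P_range_le P.K P.K) hm
    _ = 4 * max θ.ν.logσ₀ 0 * (Fintype.card (Site (F.P P.K) 0) : ℝ) := by ring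

/-- **★ `−E(P) ≤ 4·(d(𝔤)·log g₀⁻¹ + max(−log σ₀, 0))·|T^{(0)}|` ALONG A WINDOWED RUN WITH `β ≥ 0` ON THE γ-BOX** (`BetaLowerH b γ β₁₃`, `0 ≤ b`: the couplings do not decrease,
`g₀ ≤ g_j`, by `B15Claim189N0OfRecord.genSeq_mono_of_beta_nonneg`, so `log g_j⁻¹ ≤ log g₀⁻¹`), at `Efl = logz = 0`. [III] Thm 1 p.262; (1.15) p.249; [I] (0.20) p.256, §1 p.264. -/
theorem neg_EOfRecord₁₃_le_of_inInterval_of_betaLowerH (hEfl : ∀ j, θ.Efl P j = 0) (hlogz : ∀ j, θ.logz P j = 0) {γ b : ℝ} (hγ : γ ≤ 1) (hb : 0 ≤ b)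
    (hβ : BetaLowerH b γ (betaOfRecord₁₃ F N θ)) (hI : (genFlow (betaOfRecord₁₃ F N θ) P.g0).InInterval γ P.K) :
    -(EOfRecord₁₃ F N θ P) ≤ 4 * ((dimSU N : ℕ) * Real.log P.g0⁻¹ + max (-θ.ν.logσ₀) 0) * (Fintype.card (Site (F.P P.K) 0) : ℝ) := by
  rw [EOfRecord₁₃_eq_sum_of_Efl_logz θ P hEfl hlogz, ← Finset.sum_neg_distrib]
  have hI' : Step.InInterval γ P.K (gOfRecord₁₃ F N θ P) := fun k hk => hI k hk
  have hg0 := hI 0 (Nat.zero_le _)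
  have hg0eq : gOfRecord₁₃ F N θ P 0 = P.g0 := genSeq_zero _ _
  have hg0pos : 0 < P.g0 := hg0eq ▸ hg0.1
  have hg0le : P.g0 ≤ 1 := hg0eq ▸ (hg0.2.trans hγ)
  have hlog0 : 0 ≤ Real.log P.g0⁻¹ := Real.log_nonneg (one_le_inv_iff₀.mpr ⟨hg0pos, hg0le⟩)
  have hd : (0 : ℝ) ≤ (dimSU N : ℕ) := Nat.cast_nonneg _
  have hmono : ∀ j, j ≤ P.K → P.g0 ≤ gOfRecord₁₃ F N θ P j := fun j hj => by
    rw [← hg0eq]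
    exact genSeq_mono_of_beta_nonneg (betaOfRecord₁₃ F N θ) P.g0 (fun i hi => (hI i hi).1)
      (betaAlongHistory_nonneg_of_betaLowerH hb hβ hI') (Nat.zero_le j) hj
  have hstep : ∀ j ∈ Finset.range P.K,
      -((Real.log (gOfRecord₁₃ F N θ P j) * (dimSU N : ℕ) + θ.ν.logσ₀) * tstarCount (F.P P.K) j)
        ≤ ((dimSU N : ℕ) * Real.log P.g0⁻¹ + max (-θ.ν.logσ₀) 0) * tstarCount (F.P P.K) j := by
    intro j hj
    have hjK : j < P.K := Finset.mem_range.mp hj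
    have hT : 0 ≤ tstarCount (F.P P.K) j := tstarCount_P_nonneg (by simp; omega)
    have hlog : -Real.log (gOfRecord₁₃ F N θ P j) ≤ Real.log P.g0⁻¹ := by
      rw [Real.log_inv, neg_le_neg_iff]
      exact Real.log_le_log hg0pos (hmono j hjK.le)
    have h1 : -(Real.log (gOfRecord₁₃ F N θ P j) * (dimSU N : ℕ) + θ.ν.logσ₀) ≤ (dimSU N : ℕ) * Real.log P.g0⁻¹ + max (-θ.ν.logσ₀) 0 := by
      have := mul_le_mul_of_nonneg_right hlog hd
      linarith [le_max_left (-θ.ν.logσ₀) 0]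
    rw [← neg_mul]
    exact mul_le_mul_of_nonneg_right h1 hT
  refine (Finset.sum_le_sum hstep).trans ?_
  rw [← Finset.mul_sum]
  have hm : 0 ≤ (dimSU N : ℕ) * Real.log P.g0⁻¹ + max (-θ.ν.logσ₀) 0 := by
    have := mul_nonneg hd hlog0
    linarith [le_max_right (-θ.ν.logσ₀) 0]
  calc ((dimSU N : ℕ) * Real.log P.g0⁻¹ + max (-θ.ν.logσ₀) 0) * ∑ j ∈ Finset.range P.K, tstarCount (F.P P.K) j
      ≤ ((dimSU N : ℕ) * Real.log P.g0⁻¹ + max (-θ.ν.logσ₀) 0) * (4 * (Fintype.card (Site (F.P P.K) 0) : ℝ)) :=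
        mul_le_mul_of_nonneg_left (sum_tstarCount_P_range_le P.K P.K) hm
    _ = 4 * ((dimSU N : ℕ) * Real.log P.g0⁻¹ + max (-θ.ν.logσ₀) 0) * (Fintype.card (Site (F.P P.K) 0) : ℝ) := by ring

end EBounds

/-! ## §3 ★★ (UV₁₃) AT LEVEL `k = 0` in the engines' currency, with explicit dependence functions of `g₀` -/

section LevelZero

variable (θ : Stage13Params F N) (P : B12.RunParams)

/-- **★★ THE LEVEL-`0` CONJUNCT OF N13's (UV₁₃) ROW, BOTH SIDES, at every Stage-13 parameter with `Efl = logz = 0`, along every run in the window `]0, γ]`, `γ ≤ 1`, whose β-functions of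
record are `≥ b ≥ 0` on the γ-box**: for every `U`,
`χβ₀(U)·exp(−g₀⁻²·A^η₀(U) − em₀(g₀)·|T^{(0)}|) ≤ ρ₀(U) ≤ exp(ep₀(g₀)·|T^{(0)}|)` with `em₀(g₀) = 4·max(log σ₀,0) + 12·g₀⁻²`, `ep₀(g₀) = 4·(d(𝔤)·log g₀⁻¹ + max(−log σ₀,0))` — functions of
`g₀ = gOfRecord₁₃ θ P 0` alone ([III] Cor. 3: «depending on g_k»).  EXACTLY the `k = 0` instance of the hypothesis `hUV` of `…N12AtRecord13SepCoPHSockets.nodes₁₃CoPH_upS_fourPinW₀_pointed` ∕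
`N24ItemsStage13SepCoPH` once the world's `w.em ∕ w.ep` dominate `em₀ ∕ ep₀`.  `ρ₀` explicit: no estimate of Bałaban's is used. [B16] (0.1) pp.355–356; [III] Cor. 3 (2.50) p.264, Thm 1 p.262, (1.15) p.249; [I] (0.20) p.256. -/
theorem uv_zero_densOfRecord₁₃_of_Efl_logz_of_inInterval_of_betaLowerH (hEfl : ∀ j, θ.Efl P j = 0) (hlogz : ∀ j, θ.logz P j = 0)
    {γ b : ℝ} (hγ : γ ≤ 1) (hb : 0 ≤ b) (hβ : BetaLowerH b γ (betaOfRecord₁₃ F N θ)) (hI : (genFlow (betaOfRecord₁₃ F N θ) P.g0).InInterval γ P.K)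
    (U : GaugeField (F.P P.K) 0 (SU N)) :
    chiβOfRecord₁₃ F N θ P.K (gOfRecord₁₃ F N θ P) 0 U *
          Real.exp (-(1 / (gOfRecord₁₃ F N θ P 0)) ^ 2 * wilsonBGOfRecord F N θ.εbg P 0 U
            - (4 * max θ.ν.logσ₀ 0 + 12 * (1 / gOfRecord₁₃ F N θ P 0) ^ 2) * (Fintype.card (Site (F.P P.K) 0) : ℝ)) ≤ densOfRecord₁₃ F N θ P 0 U ∧
      densOfRecord₁₃ F N θ P 0 U ≤
        Real.exp (4 * ((dimSU N : ℕ) * Real.log (gOfRecord₁₃ F N θ P 0)⁻¹ + max (-θ.ν.logσ₀) 0) * (Fintype.card (Site (F.P P.K) 0) : ℝ)) := by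
  have hg0 : gOfRecord₁₃ F N θ P 0 = P.g0 := genSeq_zero _ _
  refine ⟨?_, ?_⟩
  · have h := uv_lower_zero_of_E_le θ P (EOfRecord₁₃_le_of_inInterval θ P hEfl hlogz hγ hI) U
    rw [hg0] at h ⊢
    exact h
  · rw [hg0]
    exact uv_upper_zero_of_negE_le θ P (neg_EOfRecord₁₃_le_of_inInterval_of_betaLowerH θ P hEfl hlogz hγ hb hβ hI) U

end LevelZero

/-! ## §3b The datum form: `B16.UVIneq` at the Stage-13 core-keyed datum `datumOfRecord₁₃CoPH θ h`, level `0` -/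

section Datum

variable (θ : Stage13HParams F N) (h : θ.Provisos₁₃CoPH F N) (P : B12.RunParams)

/-- **(0.1) ∕ (2.50) AT LEVEL `0` AT THE CONSTRUCTION OF RECORD** `(datumOfRecord₁₃CoPH F N θ h).C P`, in [B16]'s own carrier `B16.UVIneq`, with `E₋ = em₀(g₀)`, `E₊ = ep₀(g₀)` — through dag-n24-c's
`B16NodeKnitRecord13CoPH.uvIneq_at_record₁₃CoPH_iff` (the `k = 0` supplier of the `huv` binder of `b16_main_at_record₁₃CoPH_of_chainLetters`). [B16] (0.1) p.356; [III] (2.50) p.264. -/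
theorem uvIneq_zero_datumOfRecord₁₃CoPH_of_Efl_logz_of_inInterval_of_betaLowerH (hEfl : ∀ j, θ.Efl P j = 0) (hlogz : ∀ j, θ.logz P j = 0)
    {γ b : ℝ} (hγ : γ ≤ 1) (hb : 0 ≤ b) (hβ : BetaLowerH b γ (betaOfRecord₁₃ F N θ.toStage13Params))
    (hI : (genFlow (betaOfRecord₁₃ F N θ.toStage13Params) P.g0).InInterval γ P.K) (V : GaugeField (F.P P.K) 0 (SU N)) :
    B16.UVIneq ((datumOfRecord₁₃CoPH F N θ h).C P) 0 V
      (4 * max θ.ν.logσ₀ 0 + 12 * (1 / gOfRecord₁₃ F N θ.toStage13Params P 0) ^ 2)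
      (4 * ((dimSU N : ℕ) * Real.log (gOfRecord₁₃ F N θ.toStage13Params P 0)⁻¹ + max (-θ.ν.logσ₀) 0)) := by
  have h0 := uv_zero_densOfRecord₁₃_of_Efl_logz_of_inInterval_of_betaLowerH θ.toStage13Params P hEfl hlogz hγ hb hβ hI V
  refine (B16NodeKnitRecord13CoPH.uvIneq_at_record₁₃CoPH_iff F N θ h P 0 V _ _).mpr ⟨?_, h0.2⟩
  -- the two (0.1) currencies of the tree differ by `-(1∕g)²·A` versus `-(1∕g²·A)` (n12-d's engine row ∕ [B16]'s `UVIneq`): same real number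
  convert h0.1 using 3
  ring

end Datum

/-! ## §4 Instance: the K0⁷ witness family `θ₁₅ᶜᶜᴹᵂ(j; γ)` (`Efl = logz = 0` by construction) -/

section Witness

variable (F N)

/-- **(UV₁₃) AT LEVEL `0` AT THE WINDOWED COLLARED K0 WITNESS `theta13OfThm1CCMW F N j γ ε₀ ε₂₉ B₃ B₃' a₀ a₁`** (FILE 9's all-numerics family member: `Efl = logz = 0` by `rfl`), along every run in the
window `]0, γ']`, `γ' ≤ 1`, with `β₁₃ ≥ b ≥ 0` on the γ'-box — the K1⁷ closer's `hUV` at `k = 0` at the witness of record. [B16] (0.1) p.356; [III] (2.50) p.264, Thm 1 p.262; [I] (0.20) p.256. -/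
theorem uv_zero_densOfRecord₁₃_theta13OfThm1CCMW_of_inInterval_of_betaLowerH (j : ℕ) (γ ε₀ ε₂₉ B₃ B₃' a₀ a₁ : ℝ) (P : B12.RunParams)
    {γ' b : ℝ} (hγ : γ' ≤ 1) (hb : 0 ≤ b) (hβ : BetaLowerH b γ' (betaOfRecord₁₃ F N (theta13OfThm1CCMW F N j γ ε₀ ε₂₉ B₃ B₃' a₀ a₁)))
    (hI : (genFlow (betaOfRecord₁₃ F N (theta13OfThm1CCMW F N j γ ε₀ ε₂₉ B₃ B₃' a₀ a₁)) P.g0).InInterval γ' P.K)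
    (U : GaugeField (F.P P.K) 0 (SU N)) :
    chiβOfRecord₁₃ F N (theta13OfThm1CCMW F N j γ ε₀ ε₂₉ B₃ B₃' a₀ a₁) P.K (gOfRecord₁₃ F N (theta13OfThm1CCMW F N j γ ε₀ ε₂₉ B₃ B₃' a₀ a₁) P) 0 U *
          Real.exp (-(1 / (gOfRecord₁₃ F N (theta13OfThm1CCMW F N j γ ε₀ ε₂₉ B₃ B₃' a₀ a₁) P 0)) ^ 2 *
              wilsonBGOfRecord F N (theta13OfThm1CCMW F N j γ ε₀ ε₂₉ B₃ B₃' a₀ a₁).εbg P 0 U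
            - (4 * max (theta13OfThm1CCMW F N j γ ε₀ ε₂₉ B₃ B₃' a₀ a₁).ν.logσ₀ 0 + 12 * (1 / gOfRecord₁₃ F N (theta13OfThm1CCMW F N j γ ε₀ ε₂₉ B₃ B₃' a₀ a₁) P 0) ^ 2) *
              (Fintype.card (Site (F.P P.K) 0) : ℝ)) ≤ densOfRecord₁₃ F N (theta13OfThm1CCMW F N j γ ε₀ ε₂₉ B₃ B₃' a₀ a₁) P 0 U ∧
      densOfRecord₁₃ F N (theta13OfThm1CCMW F N j γ ε₀ ε₂₉ B₃ B₃' a₀ a₁) P 0 U ≤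
        Real.exp (4 * ((dimSU N : ℕ) * Real.log (gOfRecord₁₃ F N (theta13OfThm1CCMW F N j γ ε₀ ε₂₉ B₃ B₃' a₀ a₁) P 0)⁻¹
          + max (-(theta13OfThm1CCMW F N j γ ε₀ ε₂₉ B₃ B₃' a₀ a₁).ν.logσ₀) 0) * (Fintype.card (Site (F.P P.K) 0) : ℝ)) :=
  uv_zero_densOfRecord₁₃_of_Efl_logz_of_inInterval_of_betaLowerH _ P (fun _ => rfl) (fun _ => rfl) hγ hb hβ hI U

end Witness

/-! ## §5 (v1.1) THE ENGINES' ROW `hUV` REDUCED TO ITS LEVELS `k ≥ 1` BY NAME: level `0` from §3 under DOMINATION of `em₀ ∕ ep₀` by the world's dependence functions -/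

section Reduce

variable (θ : Stage13HParams F N)

/-- **★ `hUV` ⟸ (its levels `k ≥ 1`) + DOMINATION AT LEVEL `0`** — the (UV₁₃) hypothesis of dag-n12-d's `nodes₁₃CoPH_upS_fourPinW₀_pointed` ∕ dag-n24-c's `N24ItemsStage13SepCoPH` four-pin family, VERBATIM
(window `γ`, dependence functions `em ep : ℝ → ℝ` — the world's `w.γ`, `w.em`, `w.ep`), at every v1.7 parameter with `Efl = logz = 0` whose β-functions of record are `≥ b ≥ 0` on the γ-box, `γ ≤ 1`:
supplied from (i) `hdom` — on `]0, γ]` the world's functions dominate §3's `em₀(g) = 4·max(log σ₀,0) + 12·g⁻²`, `ep₀(g) = 4·(d(𝔤)·log g⁻¹ + max(−log σ₀,0))` (free to arrange: `WorldP.em ∕ ep`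
are unconstrained functions) — and (ii) `hsucc` — the SAME row at the levels `k + 1 ≤ P.K` only ([B16] Thm 1 + Cor. 3 proper; UNOWNED, displayed).  Level `0` is §3; the `SLaw` antecedent is not
read there. [B16] (0.1) pp.355–356; [III] Cor. 3 (2.50) p.264, Thm 1 p.262; [I] (0.20) p.256. -/
theorem hUV_of_succ_of_dom (hEfl : ∀ P j, θ.Efl P j = 0) (hlogz : ∀ P j, θ.logz P j = 0) (em ep : ℝ → ℝ) {γ b : ℝ} (hγ : γ ≤ 1) (hb : 0 ≤ b)
    (hβ : BetaLowerH b γ (betaOfRecord₁₃ F N θ.toStage13Params))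
    (hdom : ∀ g : ℝ, 0 < g → g ≤ γ →
      4 * max θ.ν.logσ₀ 0 + 12 * (1 / g) ^ 2 ≤ em g ∧ 4 * ((dimSU N : ℕ) * Real.log g⁻¹ + max (-θ.ν.logσ₀) 0) ≤ ep g)
    (hsucc : ∀ P : B12.RunParams, (genFlow (betaOfRecord₁₃ F N θ.toStage13Params) P.g0).InInterval γ P.K → ∀ k, k + 1 ≤ P.K → SLaw₁₃CoPH F N θ P (k + 1) →
      ∀ U : GaugeField (F.P P.K) (k + 1) (SU N),
        chiβOfRecord₁₃ F N θ.toStage13Params P.K (gOfRecord₁₃ F N θ.toStage13Params P) (k + 1) U *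
              Real.exp (-(1 / (gOfRecord₁₃ F N θ.toStage13Params P (k + 1))) ^ 2 * wilsonBGOfRecord F N θ.toStage13Params.εbg P (k + 1) U
                - em (gOfRecord₁₃ F N θ.toStage13Params P (k + 1)) * (Fintype.card (Site (F.P P.K) (k + 1)) : ℝ)) ≤ densOfRecord₁₃ F N θ.toStage13Params P (k + 1) U ∧
        densOfRecord₁₃ F N θ.toStage13Params P (k + 1) U ≤ Real.exp (ep (gOfRecord₁₃ F N θ.toStage13Params P (k + 1)) * (Fintype.card (Site (F.P P.K) (k + 1)) : ℝ))) :
    ∀ P : B12.RunParams, (genFlow (betaOfRecord₁₃ F N θ.toStage13Params) P.g0).InInterval γ P.K → ∀ k, k ≤ P.K → SLaw₁₃CoPH F N θ P k →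
      ∀ U : GaugeField (F.P P.K) k (SU N),
        chiβOfRecord₁₃ F N θ.toStage13Params P.K (gOfRecord₁₃ F N θ.toStage13Params P) k U *
              Real.exp (-(1 / (gOfRecord₁₃ F N θ.toStage13Params P k)) ^ 2 * wilsonBGOfRecord F N θ.toStage13Params.εbg P k U
                - em (gOfRecord₁₃ F N θ.toStage13Params P k) * (Fintype.card (Site (F.P P.K) k) : ℝ)) ≤ densOfRecord₁₃ F N θ.toStage13Params P k U ∧
        densOfRecord₁₃ F N θ.toStage13Params P k U ≤ Real.exp (ep (gOfRecord₁₃ F N θ.toStage13Params P k) * (Fintype.card (Site (F.P P.K) k) : ℝ)) := by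
  intro P hI k hk hS U
  cases k with
  | succ k => exact hsucc P hI k hk hS U
  | zero =>
    have h0 := uv_zero_densOfRecord₁₃_of_Efl_logz_of_inInterval_of_betaLowerH θ.toStage13Params P (hEfl P) (hlogz P) hγ hb hβ hI U
    have hg := hI 0 (Nat.zero_le _)
    have hd := hdom (gOfRecord₁₃ F N θ.toStage13Params P 0) hg.1 hg.2
    have hcard : 0 ≤ (Fintype.card (Site (F.P P.K) 0) : ℝ) := Nat.cast_nonneg _
    have hχ0 : 0 ≤ chiβOfRecord₁₃ F N θ.toStage13Params P.K (gOfRecord₁₃ F N θ.toStage13Params P) 0 U :=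
      (chiFix29OfRecord_mem_Icc (F := F) (N := N) θ.ν θ.ε₂₉ P.K 0 U).1
    refine ⟨?_, h0.2.trans (Real.exp_le_exp.mpr (mul_le_mul_of_nonneg_right hd.2 hcard))⟩
    refine le_trans (mul_le_mul_of_nonneg_left (Real.exp_le_exp.mpr ?_) hχ0) h0.1
    have := mul_le_mul_of_nonneg_right hd.1 hcard
    linarith

end Reduce

end Summit.QuantumFields.YangMills.BalabanUVNodes.N13UV01LevelZeroAtRecord13
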